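import Summits.CriticalPhenomena.PercolationContinuityZ3.Theorems.PercAnnulusCrossingHarrisSlackRenewal
import Summits.CriticalPhenomena.PercolationContinuityZ3.Theorems.PercAnnulusCrossingNoiseSmallSetsTwoPoint
import HarnessLib

/-!
# RSW3 lane (lead, gen 23): ANATOMY OF THE HARRIS SLACK, XI — noise sensitivity ⇔ pivotal renewal (abstract), and the pivotal pairs of a long
# connection are all renewed by noise (every `d`, every `0 < p < 1`, quantitatively in the connection probability)

builds on p205010 (kernel theorem, internal audit signed; external expert review pending) — NOT used in this file (every `p`; the two-point input is
gen 22's small-set expansion, valid at every `0 < p < 1`).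

Cell `prim-rsw3` (LANE 3), lead seat, gen 23.  Support file (`--supports stmt-CriticalPhenomena-4575`); no definitions, no named facts,
no sorries.  `J_f(ε) = Σ_i p_i(1−p_i)E[D_i f(ω)D_i f(ω^ε)]` the pivotal autocorrelation (part V), `N_f(ε) = E[f(ω)f(ω^ε)] − E[f]²` the noise correlation
above the squared mean (gens 20–21).

* §1 (abstract, every `p ∈ [0,1]^ι`, every real `f`): **`noise_correlation_sub_sq_le_mul_pivotal_autocorrelation`** — `N_f(ε) ≤ (1−ε)·J_f(ε)` for
  `ε ≤ 1` (`N_f(ε) = ∫_ε^1 J_f ≤ (1−ε)J_f(ε)`, `J_f` non-increasing); with part VI's `(ε/2)·J_f(ε) ≤ N_f(ε/2)`: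
  NOISE SENSITIVITY OF A SEQUENCE (`N_{f_n}(ε) → 0 ∀ ε > 0`) IS EQUIVALENT TO PIVOTAL RENEWAL (`J_{f_n}(ε) → 0 ∀ ε > 0`).
* §2 (lattice, every `d`, `N`, `a, b ∈ Λ(N)`, `0 < p < 1`, `0 < ε ≤ 1`, every `k`; `τ = P_p(a ↔ b inside Λ(N))`):
  **`twoPoint_pivotal_autocorrelation_le`** — `J^{ab}(ε) ≤ (2/ε)·((p(1−p))^{−k}·τ√τ + (1 − ε/2)^{k+1}·τ)`: the `p(1−p)`-weighted expected number of
  pairs pivotal for `{a ↔ b in Λ(N)}` both in `ω` and in `ω^ε` is `O_{p,ε}(τ^{1+c})` — for LONG (critical or subcritical) connections, `τ → 0`,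
  NO PIVOTAL (CUT) PAIR SURVIVES THE NOISE, conditionally on the connection, while the expected number of cut pairs given the connection is
  `≥ c_p·log(1/(4τ))` (gen 22 `twoPoint_pivotal_ge_log`).

References: C. Garban, G. Pete, O. Schramm, Acta Math. 205 (2010) §1; I. Benjamini, G. Kalai, O. Schramm, Publ. IHÉS 90 (1999); R. O'Donnell,
CUP 2014, §2.4, §9.5, §10.1.
-/

noncomputable section

/-! ## §1 Noise sensitivity ⇔ pivotal renewal -/

namespace Summit.CriticalPhenomena.PercolationContinuityZ3.Theorems.Crossing.Spectral

open Finset Function MeasureTheory intervalIntegral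
open Literature.Probability.ODonnellSaksSchrammServedio2005

variable {ι : Type*} [Fintype ι] [DecidableEq ι] (p : ι → ℝ) (h0 : ∀ i, 0 ≤ p i) (h1 : ∀ i, p i ≤ 1)

include h0 h1 in
/-- **`N_f(ε) ≤ (1−ε)·J_f(ε)`** for every real `f`, every `p ∈ [0,1]^ι`, `ε ≤ 1`: the noise correlation above the squared mean is
`∫_ε^1 J_f ≤ (1−ε)·J_f(ε)` (part V: `J_f` non-increasing).  With part VI (`(ε/2)J_f(ε) ≤ N_f(ε/2)`): noise sensitivity ⇔ pivotal renewal.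
[cite: ODonnell2014, §2.4 (Stab_ρ = Σ_S ρ^{|S|}f̂(S)²)] [cite: GarbanSteif2014, Ch. IV (1.4)] -/
theorem noise_correlation_sub_sq_le_mul_pivotal_autocorrelation (f : (ι → Bool) → ℝ) {ε : ℝ} (hε1 : ε ≤ 1) :
    (∑ x : ι → Bool, ∑ y : ι → Bool, ∑ m : ι → Bool, wt p x * wt p y * wt (fun _ => ε) m
          * (f x * f (fun i => if m i = true then y i else x i))) - (∑ x : ι → Bool, wt p x * f x) ^ 2
      ≤ (1 - ε) * (∑ i, p i * (1 - p i) * ∑ x : ι → Bool, ∑ y : ι → Bool, ∑ m : ι → Bool, wt p x * wt p y * wt (fun _ => ε) m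
        * ((f (update x i true) - f (update x i false))
          * (f (update (fun j => if m j = true then y j else x j) i true)
            - f (update (fun j => if m j = true then y j else x j) i false)))) := by
  have hint := noise_cross_correlation_sub_eq_integral p h0 h1 f f ε 1
  rw [noise_one_eq p f f] at hint
  rw [sq, hint]
  have hconst := intervalIntegral.integral_const (a := ε) (b := 1)
    (∑ i, p i * (1 - p i) * ∑ x : ι → Bool, ∑ y : ι → Bool, ∑ m : ι → Bool, wt p x * wt p y * wt (fun _ => ε) m
        * ((f (update x i true) - f (update x i false))
          * (f (update (fun j => if m j = true then y j else x j) i true)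
            - f (update (fun j => if m j = true then y j else x j) i false))))
  rw [smul_eq_mul] at hconst
  rw [← hconst]
  exact intervalIntegral.integral_mono_on hε1 (intervalIntegrable_pivotal_autocorrelation p h0 h1 f ε 1) intervalIntegrable_const
    fun ε' hε' => pivotal_autocorrelation_antitone p h0 h1 f hε'.1 hε'.2

end Summit.CriticalPhenomena.PercolationContinuityZ3.Theorems.Crossing.Spectral

/-! ## §2 The pivotal pairs of a long connection are renewed by noise -/

namespace Summit.CriticalPhenomena.PercolationContinuityZ3.Theorems.Crossing

open MeasureTheory Finset Function Filter Topology
open Literature.Probability.Percolation Literature.Probability.LatticeModels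
open Literature.Probability.ODonnellSaksSchrammServedio2005
open Literature.Probability.ODonnellSaksSchrammServedio2005.Strategy
open Literature.Probability.Percolation.GhostExploration Literature.Probability.Percolation.SeedExploration
open Literature.Probability.Percolation.OneArmOSSS Literature.Probability.Percolation.DCT16
open Summit.CriticalPhenomena.PercolationContinuityZ3.Theorems.SurfaceTension
open Summit.CriticalPhenomena.PercolationContinuityZ3.Theorems.CrossingRevealment
open Summit.CriticalPhenomena.PercolationContinuityZ3.Theorems.Crossing.Spectral

variable {d : ℕ}

/-- **THE PIVOTAL PAIRS OF A LONG CONNECTION ARE RENEWED BY NOISE** (every `d`, `N`, `a, b ∈ Λ(N)`, `0 < p < 1`, `0 < ε ≤ 1`, every `k`;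
`τ = P_p(a ↔ b inside Λ(N))`, `g = 𝟙{a ↔ b}` read on the cube of `Λ(N)`, `b_e = boxBias`):
`Σ_e b_e(1−b_e)·E_p[D_e g(ω)·D_e g(ω^ε)] ≤ (2/ε)·((p(1−p))^{−k}·τ·√τ + (1 − ε/2)^{k+1}·τ)` — part VI's `(ε/2)J(ε) ≤ E[g g^{ε/2}] − τ² ≤ E[g g^{ε/2}]`
and gen 22's small-set expansion for the two-point event.  As `τ → 0` (long connections at or below `p_c`) the right side is `o(τ)`
(`inf_k`): conditionally on `a ↔ b`, the expected number of cut pairs still pivotal after an ε-noise tends to `0`, against `≥ c_p·log(1/(4τ))` cut pairs.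
[cite: GarbanPeteSchramm2010, §1] [cite: ODonnell2014, §9.5 / §10.1 (small-set expansion)] -/
theorem twoPoint_pivotal_autocorrelation_le {N : ℕ} (a b : BoxV d N) (p : unitInterval) (hp0 : 0 < (p : ℝ)) (hp1 : (p : ℝ) < 1)
    {ε : ℝ} (hε0 : 0 < ε) (hε1 : ε ≤ 1) (k : ℕ) :
    ∑ e : PairIdx d N, boxBias d N p e * (1 - boxBias d N p e)
        * ∑ x : PairIdx d N → Bool, ∑ y : PairIdx d N → Bool, ∑ ν : PairIdx d N → Bool,
          wt (boxBias d N p) x * wt (boxBias d N p) y * wt (fun _ => ε) ν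
          * ((gcross (latEdge d N) ({a} : Set (BoxV d N)) {b} (update x e true) - gcross (latEdge d N) ({a} : Set (BoxV d N)) {b} (update x e false))
            * (gcross (latEdge d N) ({a} : Set (BoxV d N)) {b} (update (fun j => if ν j = true then y j else x j) e true)
              - gcross (latEdge d N) ({a} : Set (BoxV d N)) {b} (update (fun j => if ν j = true then y j else x j) e false)))
      ≤ (2 / ε) * ((((p : ℝ) * (1 - p)) ^ k)⁻¹ * ((bondPercolation (zdGraph d) p).real (openConnIn (↑(box d N) : Set (Site d)) a.1 b.1)
            * Real.sqrt ((bondPercolation (zdGraph d) p).real (openConnIn (↑(box d N) : Set (Site d)) a.1 b.1)))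
          + (1 - ε / 2) ^ (k + 1) * (bondPercolation (zdGraph d) p).real (openConnIn (↑(box d N) : Set (Site d)) a.1 b.1)) := by
  classical
  have hε2 : 0 < ε / 2 := by linarith
  have h := mul_pivotal_autocorrelation_le (boxBias d N p) (boxBias_nonneg N p.2.1) (boxBias_le_one N p.2.2)
    (gcross (latEdge d N) ({a} : Set (BoxV d N)) {b}) (by linarith : ε / 2 ≤ ε) hε1
  have hεε : ε - ε / 2 = ε / 2 := by ring
  rw [hεε] at h
  have h2 := le_two_div_mul hε0 (h.trans (sub_le_self _ (sq_nonneg _)))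
  refine h2.trans (mul_le_mul_of_nonneg_left ?_ (by positivity))
  exact twoPoint_noise_correlation_le_small_set a b p hp0 hp1 hε2.le (by linarith) k

end Summit.CriticalPhenomena.PercolationContinuityZ3.Theorems.Crossing

end
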